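import Literature.Computability.Cryptography.CubicClassSamplingSpecs
import HarnessLib

/-!
# The class-group stage: decoding one unit outcome (slices, signed residues, angles)

Topic `Computability/Cryptography`; theorem-only file, no named facts. Companion of `CubicClassPost.lean`
(`PostParams.decodeUnit`, `PostParams.phi`) and `CubicClassSamplingSpecs.lean` (`Acc`): the bookkeeping that identifies the
ACCURATE OUTCOMES `Acc P μ' δ kk ξ` of one Fourier-sampling unit with the SLICES of the character `c = 2^(top+aexp)·(k₀ + 2^s ν)`:

* `decodeUnit_eq_none_of_not_dvd` — characters off the multiples of `2^(top+aexp)` do not decode;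
* `decodeUnit_mul` — `2^(top+aexp) k'` decodes through `k₀ = k' mod 2^s`, `ν = k'/2^s`: `(k₀, ν)` if `k₀ ≤ K₀`,
  `(k₀ − 2^s, ν + 1 mod W)` if `k₀ ≥ 2^s − K₀`, nothing otherwise;
* `abs_phi_angle_eq` — with the coupling `μ'_t = μ_t + 2^-s M^-(T−t)` (`M = 2^ℓe`), the decoded angle
  `φ_t(ν̃) − kk μ'_t − ξ_t` is, up to sign and an integer, `k₀/(2^s M^{T−t}) + kk μ_t + ξ_t + ν/M^{T−t}`;
* `mem_Acc_slice_iff` — `2^(top+aexp)(k₀ + 2^s ν) ∈ Acc ⟨T, ℓe, s, aexp, top, K₀, B⟩ μ' δ kk ξ` iff `kk` is the signed residue of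
  `k₀` in the window `|kk| ≤ K₀` and every angle `k₀/(2^s M^{T−t}) + kk μ_t + ξ_t + ν/M^{T−t}` is within `δ` of `ℤ`.
[Hallgren 2005, §4; Kitaev 1995, §4]

## References

* S. Hallgren, STOC 2005, §4. [Hallgren2005]
* A. Yu. Kitaev, arXiv:quant-ph/9511026 (1995), §4. [Kitaev1995]
-/

noncomputable section

open scoped Classical

namespace Literature.Computability.Cryptography

namespace CubicClassSampling

open CubicClassPost

/-! ### Decoding a character -/

/-- Characters that are not multiples of `2^(top+aexp)` do not decode. [cite: Hallgren2005, §4] -/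
theorem decodeUnit_eq_none_of_not_dvd (T ℓe s aexp top K₀ B c : ℕ) (h : ¬ 2 ^ (top + aexp) ∣ c) :
    (⟨T, ℓe, s, aexp, top, K₀, B⟩ : PostParams).decodeUnit c = none := by
  unfold PostParams.decodeUnit
  rw [if_neg]
  rintro ⟨h1, h2⟩
  exact h (by rw [pow_add]; exact (Nat.dvd_div_iff_mul_dvd h1).1 h2)

/-- **Decoding a multiple of `2^(top+aexp)`**: through `k₀ = k' mod 2^s` and `ν = k' / 2^s`. [cite: Hallgren2005, §4] -/
theorem decodeUnit_mul (T ℓe s aexp top K₀ B k' : ℕ) :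
    (⟨T, ℓe, s, aexp, top, K₀, B⟩ : PostParams).decodeUnit (2 ^ (top + aexp) * k') =
      if k' % 2 ^ s ≤ K₀ then some (((k' % 2 ^ s : ℕ) : ℤ), (k' / 2 ^ s) % 2 ^ (ℓe * T))
      else if 2 ^ s - K₀ ≤ k' % 2 ^ s then
        some (((k' % 2 ^ s : ℕ) : ℤ) - (2 ^ s : ℕ), (k' / 2 ^ s + 1) % 2 ^ (ℓe * T))
      else none := by
  have htop : 0 < 2 ^ top := pow_pos (by norm_num) _
  have haexp : 0 < 2 ^ aexp := pow_pos (by norm_num) _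
  have h1 : 2 ^ (top + aexp) * k' / 2 ^ top = 2 ^ aexp * k' := by
    rw [pow_add, mul_assoc, Nat.mul_div_cancel_left _ htop]
  have h2 : 2 ^ aexp * k' / 2 ^ aexp = k' := Nat.mul_div_cancel_left _ haexp
  unfold PostParams.decodeUnit
  rw [if_pos ⟨⟨2 ^ aexp * k', by rw [pow_add, mul_assoc]⟩, by rw [h1]; exact ⟨k', rfl⟩⟩]
  simp only [h1, h2, PostParams.W]

/-! ### The decoded angle -/

/-- **The decoded angle of a slice.** For `k₀ = kk + 2^s m` and `ν + m = 2^(ℓe T) q + ν̃` (the two decoding cases are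
`m = q = 0` and `m = 1`): with `μ'_t = μ_t + 2^-s M^-(T−t)`,
`φ_t(ν̃) − kk μ'_t − ξ = −(k₀/(2^s M^{T−t}) + kk μ_t + ξ + ν/M^{T−t}) + q M^t`, so both have the same distance to `ℤ`.
[cite: Kitaev1995, §4] -/
theorem abs_phi_angle_eq (T ℓe s aexp top K₀ B : ℕ) (μ : Fin T → ℝ) (ξ : ℝ) (k₀ ν νt m q : ℕ) (kk : ℤ)
    (hm : (k₀ : ℤ) = kk + (2 ^ s : ℕ) * m) (hq : ν + m = 2 ^ (ℓe * T) * q + νt) (t : Fin T) :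
    |(((⟨T, ℓe, s, aexp, top, K₀, B⟩ : PostParams).phi νt (t : ℕ) : ℚ) : ℝ) -
        (kk : ℝ) * (μ t + 1 / (((2 ^ s : ℕ) : ℝ) * ((2 ^ ℓe : ℕ) : ℝ) ^ (T - (t : ℕ)))) - ξ -
      round ((((⟨T, ℓe, s, aexp, top, K₀, B⟩ : PostParams).phi νt (t : ℕ) : ℚ) : ℝ) -
        (kk : ℝ) * (μ t + 1 / (((2 ^ s : ℕ) : ℝ) * ((2 ^ ℓe : ℕ) : ℝ) ^ (T - (t : ℕ)))) - ξ)| =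
    |(k₀ : ℝ) / (((2 ^ s : ℕ) : ℝ) * ((2 ^ ℓe : ℕ) : ℝ) ^ (T - (t : ℕ))) + (kk : ℝ) * μ t + ξ +
        (ν : ℝ) / ((2 ^ ℓe : ℕ) : ℝ) ^ (T - (t : ℕ)) -
      round ((k₀ : ℝ) / (((2 ^ s : ℕ) : ℝ) * ((2 ^ ℓe : ℕ) : ℝ) ^ (T - (t : ℕ))) + (kk : ℝ) * μ t + ξ +
        (ν : ℝ) / ((2 ^ ℓe : ℕ) : ℝ) ^ (T - (t : ℕ)))| := by
  set M : ℝ := ((2 ^ ℓe : ℕ) : ℝ) with hM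
  set S : ℝ := ((2 ^ s : ℕ) : ℝ) with hS
  set y : ℝ := (k₀ : ℝ) / (S * M ^ (T - (t : ℕ))) + (kk : ℝ) * μ t + ξ + (ν : ℝ) / M ^ (T - (t : ℕ)) with hy
  have hMpos : (0 : ℝ) < M := by rw [hM]; positivity
  have hSpos : (0 : ℝ) < S := by rw [hS]; positivity
  have hMT : M ^ (T - (t : ℕ)) * M ^ (t : ℕ) = (2 : ℝ) ^ (ℓe * T) := by
    rw [← pow_add, Nat.sub_add_cancel t.isLt.le, hM]; push_cast; rw [← pow_mul]
  -- the decoded angle is `−y + q M^t`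
  have hphi : (((⟨T, ℓe, s, aexp, top, K₀, B⟩ : PostParams).phi νt (t : ℕ) : ℚ) : ℝ) = -(νt : ℝ) / M ^ (T - (t : ℕ)) := by
    simp only [PostParams.phi, hM]
    push_cast
    rw [pow_mul]
    ring
  have hmR : (k₀ : ℝ) = kk + S * m := by rw [hS]; exact_mod_cast hm
  have hqR : (ν : ℝ) + m = (2 : ℝ) ^ (ℓe * T) * q + νt := by exact_mod_cast hq
  have key : -(νt : ℝ) / M ^ (T - (t : ℕ)) - (kk : ℝ) * (μ t + 1 / (S * M ^ (T - (t : ℕ)))) - ξ =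
      -y + (q : ℝ) * M ^ (t : ℕ) := by
    have hA : (M ^ (T - (t : ℕ)) : ℝ) ≠ 0 := pow_ne_zero _ hMpos.ne'
    rw [← hMT] at hqR
    have e : (-(νt : ℝ) / M ^ (T - (t : ℕ)) - (kk : ℝ) * (μ t + 1 / (S * M ^ (T - (t : ℕ)))) - ξ) -
        (-y + (q : ℝ) * M ^ (t : ℕ)) =
        ((ν : ℝ) + m - νt - M ^ (T - (t : ℕ)) * M ^ (t : ℕ) * q) / M ^ (T - (t : ℕ)) := by
      rw [hy, hmR]
      field_simp
      ring
    have hz : (ν : ℝ) + m - νt - M ^ (T - (t : ℕ)) * M ^ (t : ℕ) * q = 0 := by linarith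
    rw [hz, zero_div, sub_eq_zero] at e
    exact e
  have hn : (((q * (2 ^ ℓe) ^ (t : ℕ) : ℕ) : ℤ) : ℝ) = (q : ℝ) * M ^ (t : ℕ) := by
    rw [hM]; push_cast; ring
  rw [hphi, key, ← hn, round_add_intCast]
  push_cast
  rw [show -y + (q : ℝ) * ((2 : ℝ) ^ ℓe) ^ (t : ℕ) - (round (-y) + (q : ℝ) * ((2 : ℝ) ^ ℓe) ^ (t : ℕ)) =
    -y - round (-y) by ring]
  -- `|−y − round(−y)| = |y − round y|`
  apply le_antisymm
  · calc |-y - round (-y)| ≤ |-y - ((-round y : ℤ) : ℝ)| := round_le (-y) (-round y)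
      _ = |y - round y| := by push_cast; rw [show -y - -(round y : ℝ) = -(y - round y) by ring, abs_neg]
  · calc |y - round y| ≤ |y - ((-round (-y) : ℤ) : ℝ)| := round_le y (-round (-y))
      _ = |-y - round (-y)| := by push_cast; rw [show y - -(round (-y) : ℝ) = -(-y - round (-y)) by ring, abs_neg]

/-! ### Accurate outcomes of a slice -/

/-- **The accurate outcomes of a slice.** For `k₀ < 2^s`, `ν < 2^(ℓe T)` and `2K₀ < 2^s`:
`2^(top+aexp)(k₀ + 2^s ν) ∈ Acc ⟨T, ℓe, s, aexp, top, K₀, B⟩ μ' δ kk ξ` (coupling `μ'_t = μ_t + 2^-s M^-(T−t)`) iff `kk` is the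
signed residue of `k₀` in the window (`kk = k₀ ≤ K₀`, or `kk = k₀ − 2^s` with `k₀ ≥ 2^s − K₀`) and every angle
`k₀/(2^s M^{T−t}) + kk μ_t + ξ_t + ν/M^{T−t}` is within `δ` of an integer. [cite: Hallgren2005, §4] -/
theorem mem_Acc_slice_iff : ∀ (T ℓe s aexp top K₀ B : ℕ) (μ : Fin T → ℝ) (δ : ℝ) (ξ : Fin T → ℚ) {k₀ ν : ℕ},
    k₀ < 2 ^ s → ν < 2 ^ (ℓe * T) → 2 * K₀ < 2 ^ s → ∀ (kk : ℤ),
    2 ^ (top + aexp) * (k₀ + 2 ^ s * ν) ∈ Acc ⟨T, ℓe, s, aexp, top, K₀, B⟩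
        (fun t => μ t + 1 / (((2 ^ s : ℕ) : ℝ) * ((2 ^ ℓe : ℕ) : ℝ) ^ (T - (t : ℕ)))) δ kk ξ ↔
      ((k₀ ≤ K₀ ∧ kk = k₀) ∨ (2 ^ s - K₀ ≤ k₀ ∧ kk = (k₀ : ℤ) - (2 ^ s : ℕ))) ∧
      ∀ t : Fin T, |(k₀ : ℝ) / (((2 ^ s : ℕ) : ℝ) * ((2 ^ ℓe : ℕ) : ℝ) ^ (T - (t : ℕ))) + (kk : ℝ) * μ t + (ξ t : ℝ) +
          (ν : ℝ) / ((2 ^ ℓe : ℕ) : ℝ) ^ (T - (t : ℕ)) -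
        round ((k₀ : ℝ) / (((2 ^ s : ℕ) : ℝ) * ((2 ^ ℓe : ℕ) : ℝ) ^ (T - (t : ℕ))) + (kk : ℝ) * μ t + (ξ t : ℝ) +
          (ν : ℝ) / ((2 ^ ℓe : ℕ) : ℝ) ^ (T - (t : ℕ)))| ≤ δ := by
  intro T ℓe s aexp top K₀ B μ δ ξ k₀ ν hk₀ hν hK kk
  have hS : 0 < 2 ^ s := pow_pos (by norm_num) _
  have hmod : (k₀ + 2 ^ s * ν) % 2 ^ s = k₀ := by rw [Nat.add_mul_mod_self_left, Nat.mod_eq_of_lt hk₀]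
  have hdiv : (k₀ + 2 ^ s * ν) / 2 ^ s = ν := by rw [Nat.add_mul_div_left _ _ hS, Nat.div_eq_of_lt hk₀, zero_add]
  simp only [Acc, Set.mem_setOf_eq, distZ, decodeUnit_mul, hmod, hdiv, Nat.mod_eq_of_lt hν]
  by_cases h1 : k₀ ≤ K₀
  · -- decodes to `(k₀, ν)`
    have hno : ¬ (2 ^ s - K₀ ≤ k₀) := by omega
    rw [if_pos h1]
    constructor
    · rintro ⟨νt, heq, hang⟩
      simp only [Option.some.injEq, Prod.mk.injEq] at heq
      obtain ⟨hkk, hνt⟩ := heq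
      subst hνt
      refine ⟨Or.inl ⟨h1, hkk.symm⟩, fun t => ?_⟩
      rw [← abs_phi_angle_eq T ℓe s aexp top K₀ B μ (ξ t) k₀ ν ν 0 0 kk (by rw [← hkk]; simp) (by simp) t]
      exact hang t
    · rintro ⟨hcase, hang⟩
      have hkk : kk = k₀ := by
        rcases hcase with ⟨-, h⟩ | ⟨h, -⟩
        · exact h
        · exact absurd h hno
      refine ⟨ν, by rw [hkk], fun t => ?_⟩
      rw [abs_phi_angle_eq T ℓe s aexp top K₀ B μ (ξ t) k₀ ν ν 0 0 kk (by rw [hkk]; simp) (by simp) t]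
      exact hang t
  · by_cases h2 : 2 ^ s - K₀ ≤ k₀
    · -- decodes to `(k₀ − 2^s, (ν+1) mod W)`
      rw [if_neg h1, if_pos h2]
      have hq : ν + 1 = 2 ^ (ℓe * T) * ((ν + 1) / 2 ^ (ℓe * T)) + (ν + 1) % 2 ^ (ℓe * T) :=
        (Nat.div_add_mod _ _).symm
      constructor
      · rintro ⟨νt, heq, hang⟩
        simp only [Option.some.injEq, Prod.mk.injEq] at heq
        obtain ⟨hkk, hνt⟩ := heq
        subst hνt
        refine ⟨Or.inr ⟨h2, hkk.symm⟩, fun t => ?_⟩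
        rw [← abs_phi_angle_eq T ℓe s aexp top K₀ B μ (ξ t) k₀ ν _ 1 _ kk (by rw [← hkk]; push_cast; ring) hq t]
        exact hang t
      · rintro ⟨hcase, hang⟩
        have hkk : kk = (k₀ : ℤ) - (2 ^ s : ℕ) := by
          rcases hcase with ⟨h, -⟩ | ⟨-, h⟩
          · exact absurd h h1
          · exact h
        refine ⟨(ν + 1) % 2 ^ (ℓe * T), by rw [hkk], fun t => ?_⟩
        rw [abs_phi_angle_eq T ℓe s aexp top K₀ B μ (ξ t) k₀ ν _ 1 _ kk (by rw [hkk]; push_cast; ring) hq t]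
        exact hang t
    · -- does not decode
      rw [if_neg h1, if_neg h2]
      constructor
      · rintro ⟨νt, heq, -⟩
        exact absurd heq (by simp)
      · rintro ⟨hcase, -⟩
        rcases hcase with ⟨h, -⟩ | ⟨h, -⟩
        · exact absurd h h1
        · exact absurd h h2

end CubicClassSampling

end Literature.Computability.Cryptography
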